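import Summits.BirchSwinnertonDyer.BirchSwinnertonDyer.Theorems.GenusKolyvaginAtTwoPowDvdShaCardAtTwoRTRestrictionKernelIndexTwo
import Summits.BirchSwinnertonDyer.BirchSwinnertonDyer.Theorems.GenusKolyvaginAtTwoShaCardDvdPowAtTwoRSquareAllowance
import Summits.BirchSwinnertonDyer.BirchSwinnertonDyer.Theorems.CMKolyvaginAtInertTwoCMExactDescentAtTwo
import HarnessLib

/-!
# Route `GenusKolyvaginAtTwo`, LINE 18 / LINE 19, registered stubs `stub_genusRestrictionDvd` (L_T
# `PowDvdShaCardAtTwoRT`, stmt-BirchSwinnertonDyer-23242) and `stub_genusRestrictionDvdPos` (L⁺_T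
# `PowDvdShaCardAtTwoPosT`, stmt-BirchSwinnertonDyer-23379): GENUS RESTRICTION DIVISIBILITY
# `#Ш(E/ℚ)[2^∞] ∣ #Ш(E_K/K)[2^∞]`, MODULO the named facts `kolyvagin` (Kolyvagin 1990 Thm. A over the Heegner
# field) and `exists_casselsTate_pairing` (over `ℚ` and over `K`)

Seat `bsd-line-gk2-p3` g16 (cell `bsd-f1-sign2`), `--supports stmt-BirchSwinnertonDyer-23242` (helper; closes
nothing — the two stubs are obtained with the named facts as displayed antecedents, so this is a CONDITIONAL
result, D-0014).  THEOREMS ONLY (no definition, no new named fact, no `sorry`); BSD is not proved by any of this.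

RIGIDITY BY SQUARENESS (the pen's card `Lines/plus_descent.md`, stub 2).  On the genus habitat (`W/ℚ` globally
minimal, `ρ̄_{E,2}` onto, `K` imaginary quadratic with odd `d_K` satisfying the Heegner hypothesis, the Heegner
datum `P(1)` of infinite order):
1. `P(1)` descends to a Heegner point `P₀ ∈ E(K)` of infinite order, so `rank E(K) = 1` and `Ш(E_K)` is finite
   — Kolyvagin's theorem, the tree's named fact `Literature.NumberTheory.EllipticCurves.kolyvagin` (hypothesis
   `hKo`); finiteness descends to `Ш(E/ℚ)` (`shaFinite_of_baseChange`);
2. `E(K)[2] = 0` (`CMExactDescent.eq_zero_of_two_smul_eq_zero_baseChange`), so the kernel of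
   `Ш(E/ℚ) → Ш(E_K/K)` has order `≤ 2^{rank E(K)} = 2`
   (`PlusDescent.natCard_ker_shaRestriction_le_two_pow_mordellWeilRank`, the index-two inflation bound);
3. the restriction maps `Ш(E/ℚ)[2^∞]` into `Ш(E_K)[2^∞]` with a kernel of order `≤ 2` and an image whose
   order divides `#Ш(E_K)[2^∞]`, so `#Ш(E/ℚ)[2^∞] ∣ 2 · #Ш(E_K)[2^∞]`;
4. both orders are SQUARES (Cassels–Tate over `ℚ` and over `K`,
   `VisiblePairAtTwo.isSquare_natCard_primaryComponent_sha_of_casselsTate`), and a square dividing twice a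
   square divides it (`dvd_of_isSquare_of_dvd_two_mul`).

* §1 `dvd_of_isSquare_of_dvd_two_mul` — `IsSquare a`, `IsSquare b`, `a ∣ 2b` ⟹ `a ∣ b`.
* §2 `natCard_dvd_of_natCard_ker_le_two` — for `f : A →+ B` with `#ker f ≤ 2` and `#A`, `#B` squares:
  `#A ∣ #B` (`Nat.card`; the infinite cases read `0 ∣ 0`, `a ∣ 0`).
* §3 `natCard_primaryComponent_sha_dvd_baseChange_of_kolyvagin_of_casselsTate` — the habitat theorem.
* §4 `stub_genusRestrictionDvd_of_facts`, `stub_genusRestrictionDvdPos_of_facts` — the two registered stub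
  signatures VERBATIM behind the antecedents `∀ N W K, kolyvagin N W K` and
  `∀ K, exists_casselsTate_pairing (K := K)` (the sign of `Δ`, `¬CM`, odd Tamagawa, `d_K ≠ -3`, the two
  non-square side conditions, `M₀`, `n`, `P_n` are idle for this stub).

References: [Kramer1981] proof of Thm. 2; [Gross1991] Thm. 1.3; [Kolyvagin1990] Thm. A; [Darmon2004]
§3.9 and Exercise 3.18; [SilvermanAEC2009] Thm. X.4.14; [Cassels1962ArithmeticIV].
-/

set_option autoImplicit false
-- the Theorems namespace of this sub repeats the summit name by design (D-0017 nested layout)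
set_option linter.dupNamespace false

noncomputable section

open scoped Classical

namespace Summit.BirchSwinnertonDyer.BirchSwinnertonDyer.Theorems.GenusExact.PlusDescent

open WeierstrassCurve NumberField Literature.NumberTheory.EllipticCurves
  Literature.NumberTheory.EllipticCurves.ModularForms
  Summit.BirchSwinnertonDyer.BirchSwinnertonDyer.Theorems.GenusExact.VisiblePairAtTwo

/-! ## §1 Arithmetic: a square dividing twice a square divides it -/

/-- **A square dividing twice a square divides the square**: `IsSquare a`, `IsSquare b`, `a ∣ 2 b` ⟹
`a ∣ b` (write `a = s²`, `b = t²`, `s = s' g`, `t = t' g` with `gcd(s', t') = 1`; then `s'² ∣ 2`, so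
`s' = 1` and `s = g ∣ t`). [folklore] -/
theorem dvd_of_isSquare_of_dvd_two_mul {a b : ℕ} (ha : IsSquare a) (hb : IsSquare b) (h : a ∣ 2 * b) :
    a ∣ b := by
  obtain ⟨s, rfl⟩ := ha
  obtain ⟨t, rfl⟩ := hb
  rcases Nat.eq_zero_or_pos s with rfl | hs
  · rw [zero_mul, zero_dvd_iff, mul_eq_zero] at h
    rcases h with h | h
    · exact absurd h two_ne_zero
    · rw [h, zero_mul]
  suffices hst : s ∣ t from mul_dvd_mul hst hst
  obtain ⟨g, s', t', hg, hco, rfl, rfl⟩ := Nat.exists_coprime' (Nat.gcd_pos_of_pos_left t hs)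
  have hs' : s' ≠ 0 := by
    rintro rfl
    rw [zero_mul] at hs
    exact lt_irrefl 0 hs
  -- cancel `g²`
  have h1 : s' * s' * (g * g) ∣ 2 * (t' * t') * (g * g) := by
    have e1 : s' * g * (s' * g) = s' * s' * (g * g) := by ring
    have e2 : 2 * (t' * g * (t' * g)) = 2 * (t' * t') * (g * g) := by ring
    rwa [e1, e2] at h
  have h2 : s' * s' ∣ 2 * (t' * t') := Nat.dvd_of_mul_dvd_mul_right (Nat.mul_pos hg hg) h1
  have hco2 : (s' * s').Coprime (t' * t') := Nat.Coprime.mul_left (hco.mul_right hco) (hco.mul_right hco)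
  have h3 : s' * s' ∣ 2 := hco2.dvd_of_dvd_mul_right h2
  have h4 : s' * s' ≤ 2 := Nat.le_of_dvd two_pos h3
  have h5 : s' = 1 := by
    rcases Nat.lt_or_ge s' 2 with hlt | hge
    · omega
    · nlinarith
  rw [h5, one_mul]
  exact Dvd.intro_left _ rfl

/-! ## §2 Counting: kernel of order `≤ 2` between groups of square order -/

/-- **`#A ∣ #B` for `f : A →+ B` with `#ker f ≤ 2` (finite kernel) and `#A`, `#B` squares.** If `B` is
infinite, `#B = 0`; if `B` is finite so is `A` (finite kernel), `#A = #ker · #im` with `#ker ∈ {1, 2}` and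
`#im ∣ #B`, so `#A ∣ 2 #B`, and squareness removes the `2` (§1). [folklore] -/
theorem natCard_dvd_of_natCard_ker_le_two {A B : Type*} [AddCommGroup A] [AddCommGroup B] (f : A →+ B)
    [Finite f.ker] (hk : Nat.card f.ker ≤ 2) (hA : IsSquare (Nat.card A)) (hB : IsSquare (Nat.card B)) :
    Nat.card A ∣ Nat.card B := by
  rcases finite_or_infinite B with hBfin | hBinf
  · haveI : Fintype B := Fintype.ofFinite B
    haveI : Fintype f.ker := Fintype.ofFinite f.ker
    haveI : Fintype A := AddGroup.fintypeOfKerOfCodom f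
    refine dvd_of_isSquare_of_dvd_two_mul hA hB ?_
    have h1 : Nat.card A = Nat.card f.range * Nat.card f.ker := by
      rw [AddSubgroup.card_eq_card_quotient_mul_card_addSubgroup f.ker,
        Nat.card_congr (QuotientAddGroup.quotientKerEquivRange f).toEquiv]
    have h2 : Nat.card f.range ∣ Nat.card B := AddSubgroup.card_addSubgroup_dvd_card f.range
    have h3 : Nat.card f.ker ∣ 2 := by
      have hpos : 0 < Nat.card f.ker := Nat.card_pos
      interval_cases (Nat.card f.ker) <;> norm_num
    rw [h1, mul_comm 2]
    exact mul_dvd_mul h2 h3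
  · rw [Nat.card_eq_zero_of_infinite (α := B)]
    exact dvd_zero _

/-! ## §3 The habitat theorem: genus restriction divisibility modulo Kolyvagin and Cassels–Tate -/

/-- **GENUS RESTRICTION DIVISIBILITY `#Ш(E/ℚ)[2^∞] ∣ #Ш(E_K/K)[2^∞]`, modulo Kolyvagin's theorem over the
Heegner field and the Cassels–Tate pairing over `ℚ` and over `K`.**  `W/ℚ` globally minimal elliptic with
`ρ̄_{E,2}` onto; `K` imaginary quadratic, `d_K` odd, Heegner for `N_E`; `d₁` a Kolyvagin–Heegner datum at
conductor `1` whose point `P(1)` has infinite order.  Hypotheses BY NAME: `hKo : kolyvagin N_E W K`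
(Kolyvagin 1990 Thm. A / Gross 1991 Thm. 1.3: a non-torsion Heegner point gives `rank E(K) = 1` and `Ш(E_K)`
finite), `hCTQ`, `hCTK : exists_casselsTate_pairing` over `ℚ`, `K` (Cassels 1962; Silverman AEC X.4.14).
Proof: §2 applied to the restriction `Ш(E/ℚ)[2^∞] → Ш(E_K)[2^∞]`, whose kernel has order `≤ 2^{rank E(K)}
= 2` (`natCard_ker_shaRestriction_le_two_pow_mordellWeilRank`, with `E(K)[2] = 0`), both orders being
squares (`isSquare_natCard_primaryComponent_sha_of_casselsTate`).  CONDITIONAL on the three named facts.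
[cite: Kramer1981, proof of Thm. 2] [cite: Gross1991, Thm. 1.3] [cite: SilvermanAEC2009, Thm. X.4.14]
[cite: Darmon2004, §3.9 (proof of Thm. 3.22) and Exercise 3.18] -/
theorem natCard_primaryComponent_sha_dvd_baseChange_of_kolyvagin_of_casselsTate
    (W : WeierstrassCurve ℚ) [W.IsElliptic] [W.IsGloballyMinimal] [NeZero (W.conductorNorm ℤ)]
    (K : Type) [Field K] [NumberField K]
    (hKo : kolyvagin (W.conductorNorm ℤ) W K)
    (hCTQ : exists_casselsTate_pairing (K := ℚ)) (hCTK : exists_casselsTate_pairing (K := K))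
    (hK : IsImaginaryQuadratic K) (hodd : Odd (NumberField.discr K))
    (hH : SatisfiesHeegnerHypothesis (W.conductorNorm ℤ) K) (hρ : W.HasSurjectiveModNGaloisRep 2)
    {Dt : ModularParametrizationData W (W.conductorNorm ℤ)} {β : ℤ} {ι : K →+* ℂ}
    (d₁ : KolyvaginHeegnerData Dt β ι 1) (hy : ¬ IsOfFinAddOrder d₁.derivedPoint) :
    Nat.card (AddCommGroup.primaryComponent W.sha 2) ∣
      Nat.card (AddCommGroup.primaryComponent (W.baseChange K).sha 2) := by
  haveI hEK : (W.baseChange K).IsElliptic := by rw [WeierstrassCurve.baseChange]; infer_instance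
  have h2 : Module.finrank ℚ K = 2 := hK.1
  haveI : Algebra.IsQuadraticExtension ℚ K := ⟨h2⟩
  haveI : IsGalois ℚ K := inferInstance
  -- §3.1 the Heegner point `P₀ ∈ E(K)` below `P(1)` is non-torsion; Kolyvagin
  obtain ⟨P₀, hP₀, hP₀K⟩ := heegnerSystem_exists_isHeegnerPoint_map_eq_derivedPoint_one
    (heegnerPointOfConductor_one_galoisConj_holds (W.conductorNorm ℤ) W K) hK hH d₁
  have hPinf : ¬ IsOfFinAddOrder P₀ := by
    intro hfin
    apply hy
    rw [← hP₀K]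
    exact (WeierstrassCurve.Affine.Point.map (W' := W)
      (algebraMap K (ringClassField K ι 1)).toRatAlgHom).isOfFinAddOrder hfin
  obtain ⟨hrk, hShaK⟩ := hKo hK hH hP₀ hPinf
  -- §3.2 finiteness over `K` and over `ℚ`; squareness
  haveI hfinK : Finite (W.baseChange K).sha := hShaK
  haveI hfinQ : Finite W.sha := shaFinite_of_baseChange W K hShaK
  have hsqQ : IsSquare (Nat.card (AddCommGroup.primaryComponent W.sha 2)) :=
    isSquare_natCard_primaryComponent_sha_of_casselsTate W 2 hCTQ
  have hsqK : IsSquare (Nat.card (AddCommGroup.primaryComponent (W.baseChange K).sha 2)) :=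
    isSquare_natCard_primaryComponent_sha_of_casselsTate (W.baseChange K) 2 hCTK
  -- §3.3 `E(K)[2] = 0` and the kernel bound `≤ 2^{rank E(K)} = 2`
  have hK2 : ∀ P : (W.baseChange K).toAffine.Point, 2 • P = 0 → P = 0 := fun P hP ↦
    CMExactDescent.eq_zero_of_two_smul_eq_zero_baseChange W hK hodd hH hρ P hP
  have hker : Nat.card (shaRestriction W K).ker ≤ 2 := by
    have h := natCard_ker_shaRestriction_le_two_pow_mordellWeilRank W K h2 hK2
    rwa [hrk, pow_one] at h
  -- §3.4 the restriction on `2`-primary parts and the count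
  set A : AddSubgroup W.sha := AddCommGroup.primaryComponent W.sha 2 with hAdef
  set B : AddSubgroup (W.baseChange K).sha := AddCommGroup.primaryComponent (W.baseChange K).sha 2
    with hBdef
  have hmem : ∀ a : A, (shaRestriction W K).comp A.subtype a ∈ B := by
    intro a
    obtain ⟨n, hn⟩ := (AddCommGroup.mem_primaryComponent).mp a.2
    rw [hBdef, AddCommGroup.mem_primaryComponent]
    refine ⟨n, ?_⟩
    rw [AddMonoidHom.comp_apply, AddSubgroup.coe_subtype, ← map_nsmul, hn, map_zero]
  let fA : A →+ B := ((shaRestriction W K).comp A.subtype).codRestrict B hmem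
  have hinj : Function.Injective (fun a : fA.ker ↦ (⟨((a : A) : W.sha), by
      have ha : fA (a : A) = 0 := (AddMonoidHom.mem_ker).mp a.2
      have := congrArg (fun b : B ↦ (b : (W.baseChange K).sha)) ha
      exact (AddMonoidHom.mem_ker).mpr this⟩ : (shaRestriction W K).ker)) := by
    intro a a' h
    rw [Subtype.ext_iff] at h
    dsimp only at h
    exact Subtype.ext (Subtype.ext h)
  have hkerA : Nat.card fA.ker ≤ 2 := le_trans (Nat.card_le_card_of_injective _ hinj) hker
  exact natCard_dvd_of_natCard_ker_le_two fA hkerA hsqQ hsqK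

/-! ## §4 The two registered stubs, modulo the named facts -/

/-- **LINE 18 `stub_genusRestrictionDvd` (L_T `PowDvdShaCardAtTwoRT`, stmt-BirchSwinnertonDyer-23242) MODULO
`kolyvagin` and `exists_casselsTate_pairing`**: the registered stub signature VERBATIM as conclusion, the two
named facts (universally closed) as antecedents.  On the `Δ < 0` genus habitat, `#Ш(E/ℚ)[2^∞] ∣
#Ш(E_K/K)[2^∞]`; only `ρ̄_{E,2}` onto (`n = 1` of the tower binder), `K` imaginary quadratic with odd
Heegner `d_K`, and `P(1)` of infinite order are used.  CONDITIONAL (D-0014).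
[cite: Kramer1981, proof of Thm. 2] [cite: Gross1991, Thm. 1.3] [cite: SilvermanAEC2009, Thm. X.4.14] -/
theorem stub_genusRestrictionDvd_of_facts
    (hKo : ∀ (N : ℕ) [NeZero N] (W : WeierstrassCurve ℚ) (K : Type) [Field K] [NumberField K],
      kolyvagin N W K)
    (hCT : ∀ (K : Type) [Field K] [NumberField K], exists_casselsTate_pairing (K := K)) :
    ∀ (W : WeierstrassCurve ℚ) [W.IsElliptic] [W.IsGloballyMinimal] [NeZero (W.conductorNorm ℤ)], ¬ W.HasCM →
      Odd W.tamagawaProduct → W.Δ < 0 → ∀ (K : Type) [Field K] [NumberField K],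
      Literature.NumberTheory.EllipticCurves.IsImaginaryQuadratic K → Odd (NumberField.discr K) →
      NumberField.discr K ≠ -3 →
      Literature.NumberTheory.EllipticCurves.SatisfiesHeegnerHypothesis (W.conductorNorm ℤ) K →
      ¬ IsSquare ((NumberField.discr K : ℚ) * -|W.Δ|) → ¬ IsSquare ((NumberField.discr K : ℚ) * (-(2 * |W.Δ|))) →
      (∀ n : ℕ, 0 < n → W.HasSurjectiveModNGaloisRep ((2 : ℤ) ^ n)) →
      ∀ (Dt : Literature.NumberTheory.EllipticCurves.ModularForms.ModularParametrizationData W (W.conductorNorm ℤ))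
        (β : ℤ) (ι : K →+* ℂ) (d₁ : Literature.NumberTheory.EllipticCurves.KolyvaginHeegnerData Dt β ι 1),
      ¬ IsOfFinAddOrder d₁.derivedPoint → ∀ (M₀ : ℕ),
      (∃ Q : (W.baseChange (Literature.NumberTheory.EllipticCurves.ringClassField K ι 1)).toAffine.Point,
        ((2 ^ M₀ : ℕ) : ℤ) • Q = d₁.derivedPoint) →
      (¬ ∃ Q : (W.baseChange (Literature.NumberTheory.EllipticCurves.ringClassField K ι 1)).toAffine.Point,
        ((2 ^ (M₀ + 1) : ℕ) : ℤ) • Q = d₁.derivedPoint) →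
      ∀ (n : ℕ) (d : Literature.NumberTheory.EllipticCurves.KolyvaginHeegnerData Dt β ι n), Squarefree n →
      (∀ ℓ ∈ n.primeFactors,
        Literature.NumberTheory.EllipticCurves.Zhang2014.IsKolyvaginPrime (W.conductorNorm ℤ) W K 2 ℓ) →
      (¬ ∃ Q : (W.baseChange (Literature.NumberTheory.EllipticCurves.ringClassField K ι n)).toAffine.Point,
        (2 : ℤ) • Q = d.derivedPoint) →
      Nat.card (AddCommGroup.primaryComponent W.sha 2) ∣
        Nat.card (AddCommGroup.primaryComponent (W.baseChange K).sha 2) := by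
  intro W _ _ _ _hcm _hT _hΔ K _ _ hK hodd _h3 hH _hsq _hsq2 hsurj Dt β ι d₁ hy _M₀ _hdiv _hndiv _n _d _hn
    _hKol _hprim
  exact natCard_primaryComponent_sha_dvd_baseChange_of_kolyvagin_of_casselsTate W K (hKo _ W K) (hCT ℚ)
    (hCT K) hK hodd hH (by simpa using hsurj 1 one_pos) d₁ hy

/-- **LINE 19 `stub_genusRestrictionDvdPos` (L⁺_T `PowDvdShaCardAtTwoPosT`, stmt-BirchSwinnertonDyer-23379)
MODULO `kolyvagin` and `exists_casselsTate_pairing`**: the registered stub signature VERBATIM (`0 < W.Δ`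
instead of `W.Δ < 0`; the sign is idle) as conclusion, the named facts as antecedents.  CONDITIONAL (D-0014).
[cite: Kramer1981, proof of Thm. 2] [cite: Gross1991, Thm. 1.3] [cite: SilvermanAEC2009, Thm. X.4.14] -/
theorem stub_genusRestrictionDvdPos_of_facts
    (hKo : ∀ (N : ℕ) [NeZero N] (W : WeierstrassCurve ℚ) (K : Type) [Field K] [NumberField K],
      kolyvagin N W K)
    (hCT : ∀ (K : Type) [Field K] [NumberField K], exists_casselsTate_pairing (K := K)) :
    ∀ (W : WeierstrassCurve ℚ) [W.IsElliptic] [W.IsGloballyMinimal] [NeZero (W.conductorNorm ℤ)], ¬ W.HasCM →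
      Odd W.tamagawaProduct → 0 < W.Δ → ∀ (K : Type) [Field K] [NumberField K],
      Literature.NumberTheory.EllipticCurves.IsImaginaryQuadratic K → Odd (NumberField.discr K) →
      NumberField.discr K ≠ -3 →
      Literature.NumberTheory.EllipticCurves.SatisfiesHeegnerHypothesis (W.conductorNorm ℤ) K →
      ¬ IsSquare ((NumberField.discr K : ℚ) * -|W.Δ|) → ¬ IsSquare ((NumberField.discr K : ℚ) * (-(2 * |W.Δ|))) →
      (∀ n : ℕ, 0 < n → W.HasSurjectiveModNGaloisRep ((2 : ℤ) ^ n)) →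
      ∀ (Dt : Literature.NumberTheory.EllipticCurves.ModularForms.ModularParametrizationData W (W.conductorNorm ℤ))
        (β : ℤ) (ι : K →+* ℂ) (d₁ : Literature.NumberTheory.EllipticCurves.KolyvaginHeegnerData Dt β ι 1),
      ¬ IsOfFinAddOrder d₁.derivedPoint → ∀ (M₀ : ℕ),
      (∃ Q : (W.baseChange (Literature.NumberTheory.EllipticCurves.ringClassField K ι 1)).toAffine.Point,
        ((2 ^ M₀ : ℕ) : ℤ) • Q = d₁.derivedPoint) →
      (¬ ∃ Q : (W.baseChange (Literature.NumberTheory.EllipticCurves.ringClassField K ι 1)).toAffine.Point,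
        ((2 ^ (M₀ + 1) : ℕ) : ℤ) • Q = d₁.derivedPoint) →
      ∀ (n : ℕ) (d : Literature.NumberTheory.EllipticCurves.KolyvaginHeegnerData Dt β ι n), Squarefree n →
      (∀ ℓ ∈ n.primeFactors,
        Literature.NumberTheory.EllipticCurves.Zhang2014.IsKolyvaginPrime (W.conductorNorm ℤ) W K 2 ℓ) →
      (¬ ∃ Q : (W.baseChange (Literature.NumberTheory.EllipticCurves.ringClassField K ι n)).toAffine.Point,
        (2 : ℤ) • Q = d.derivedPoint) →
      Nat.card (AddCommGroup.primaryComponent W.sha 2) ∣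
        Nat.card (AddCommGroup.primaryComponent (W.baseChange K).sha 2) := by
  intro W _ _ _ _hcm _hT _hΔ K _ _ hK hodd _h3 hH _hsq _hsq2 hsurj Dt β ι d₁ hy _M₀ _hdiv _hndiv _n _d _hn
    _hKol _hprim
  exact natCard_primaryComponent_sha_dvd_baseChange_of_kolyvagin_of_casselsTate W K (hKo _ W K) (hCT ℚ)
    (hCT K) hK hodd hH (by simpa using hsurj 1 one_pos) d₁ hy

end Summit.BirchSwinnertonDyer.BirchSwinnertonDyer.Theorems.GenusExact.PlusDescent

end
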